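import Mathlib
import HarnessLib
import Summits.HubbardSuperconductivity.HubbardSuperconductivity.Theorems.KLProgrammeKLRegimeSplitGeoTwoShell

/-!
# Route `KLProgramme` — ENGINE item stmt-HubbardSuperconductivity-20437 `KLRegimeEngineV17F2`, stub (c) value lane, located item «(c)-OUT-XLOG-PP»:
# the PARTICLE–PARTICLE twin `GeoConsts.addShellLogPP` of the landed shell-log amendment `GeoConsts.addShellLog`
# (cell gate-hubbard-kl, seat hubbard-kl-k3c2-p2 g19; memo HOME/hubbard-kl-k3c2-p2/OUT-OF-CLASS-E2.md §8–§9a, evidence on 20437)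

WHY.  The out-of-class half of (E2″-F)ₙ₊₁ (`hout`) compares PLAIN pair amplitudes at consecutive scales; besides the same-shell flow step (i)
(`outClass_sameFrame_le_bars`, …OutClassBars) it contains the Wick re-ordering of the scale-`n` action by the shell covariance,
`[(e^{Δ_Γ} − 1)𝒢^K_{Λₙ}]₄`, `Γ = C^K_{(Λₙ₊₁,Λₙ]}` (step (iii), `outClass_endpoints_eq_plain`), whose second-order content is the CROSS-SCALE one-loop bubble
`𝒢₄·B(Γ ⊗ C^K_{>Λₙ})·𝒢₄` — one two-shell unit `≍ Λₙ₊₁/ρ` per hard shell `j ≤ n` with `Λ_j ≲ ρ` below the transfer `ρ`, i.e. the profile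
`min(ρ/Λ, Λ/ρ)·(1 + kₙ(ρ))` = `klRelGain` (k3c1-p1, …PairTransferRelBar; `kₙ = klShellCount`).  In the two particle–hole channels the engine package already
hosts this profile: `klEngGeo9 := klEngGeo8.addShellLog (2^52)` amends `phGain` by `C·(klRelGain n (ρ⊔0) + 2^{−n})` (…SplitGeoShellLog, the «(E2)-FRZ-LOG» cure).
In the particle–particle channel it does not (`addShellLog_ppGain : (G.addShellLog C).ppGain = G.ppGain`): in class the pp channel is resummed, OUT of class it is
not, and `|p_Qm| = ρ > 32Λₙ₊₁` is exactly the frozen branch where the shell count grows.  This file is the pp twin, generic in `G`: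
* §1 `sum_Ioc_klRelGain_le` (the pp freezing clause sums a SUBSET of `range (N+1)`: `≤ 40/9`), `sum_Ioc_inv_two_pow_le` (`≤ 2`, from `klgp_sum_range_inv_two_pow_le`);
* §2 **`GeoConsts.addShellLogPP G C := {G with ppGain := G.ppGain + C·(klRelGain n (ρ ⊔ 0) + 2^{−n}), CF := G.CF + 7C}`**, field lemmas,
  **`addShellLogPP_wf`** (`G.WF → 0 ≤ C → (G.addShellLogPP C).WF`), `ppGain_le_addShellLogPP`, the BOOKING LINES `klRelGain_le_addShellLogPP`
  (`C·(klRelGain n ρ + 2^{−n}) ≤ ppGain′ n ρ`) and `shellCount_le_addShellLogPP` (frozen branch `Λₙ ≤ ρ`: `C·(Λₙ/ρ)·(1 + kₙ(ρ)) ≤ ppGain′ n ρ`), `CF_le_addShellLogPP`,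
  commutation with `addShellLog`, `addTwoShell`, `raiseCF`;
* §3 the slots along the amendment: `thermalBar`, `gainBar` grow; (E5-F) lifts; (E4)/(E3a-F) do not read the gains.
Real arithmetic only; no package of record is touched (the token line `klEngGeo12 := klEngGeo11.addShellLogPP (2^52)` is the pen's FREEZE decision); nothing about
the model is asserted; nothing asserts (E2″-F), (c), K3 or superconductivity.  0 kit · 0 lit.
-/

noncomputable section

namespace Summit.HubbardSuperconductivity.HubbardSuperconductivity.Theorems.KLRegimeSplit

set_option linter.dupNamespace false -- summit = problem name (single-conjunct summit), D-0017

open Real Finset Literature.MathematicalPhysics.QuantumLattice Literature.Probability.LatticeModels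
open Summit.HubbardSuperconductivity.HubbardSuperconductivity.Theorems.KLProgrammeLegKernels
open Summit.HubbardSuperconductivity.HubbardSuperconductivity.Theorems.DispersionFlow
open Summit.HubbardSuperconductivity.HubbardSuperconductivity.Theorems.EngineV8

/-! ## §1 The pp freezing sums -/

/-- `Σ_{n ∈ (t, N]} 2^{−n} ≤ 2`. -/
theorem sum_Ioc_inv_two_pow_le (t N : ℕ) : ∑ n ∈ Ioc t N, ((2 : ℝ) ^ n)⁻¹ ≤ 2 := by
  refine le_trans (sum_le_sum_of_subset_of_nonneg (fun n hn => ?_) (fun n _ _ => by positivity)) (klgp_sum_range_inv_two_pow_le (N + 1))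
  rw [mem_Ioc] at hn; rw [mem_range]; omega

/-- **The pp freezing sum of the relative gain**: `Σ_{n ∈ (t, N]} klRelGain n ρ ≤ 40/9` (`0 ≤ ρ`) — a subset of the uniform `range` sum. -/
theorem sum_Ioc_klRelGain_le (t N : ℕ) {ρ : ℝ} (hρ : 0 ≤ ρ) : ∑ n ∈ Ioc t N, klRelGain n ρ ≤ 40 / 9 := by
  refine le_trans (sum_le_sum_of_subset_of_nonneg (fun n hn => ?_) (fun n _ _ => klRelGain_nonneg n hρ)) (sum_range_klRelGain_le (N + 1) hρ)
  rw [mem_Ioc] at hn; rw [mem_range]; omega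

/-! ## §2 The amendment `GeoConsts.addShellLogPP` -/

/-- **`G.addShellLogPP C`** — the geometric package `G` with the particle–PARTICLE gain amended by the relative gain profile and a `2^{−n}` floor:
`ppGain n ρ := G.ppGain n ρ + C·(klRelGain n (ρ ⊔ 0) + 2^{−n})`, `CF := G.CF + 7C`; every other field untouched (the pp twin of `GeoConsts.addShellLog`). -/
def GeoConsts.addShellLogPP (G : GeoConsts) (C : ℝ) : GeoConsts :=
  { G with ppGain := fun n ρ => G.ppGain n ρ + C * (klRelGain n (max ρ 0) + ((2 : ℝ) ^ n)⁻¹), CF := G.CF + 7 * C }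

namespace GeoConsts

variable (G : GeoConsts) (C : ℝ)

/-- the amended pp gain -/
theorem addShellLogPP_ppGain (n : ℕ) (ρ : ℝ) : (G.addShellLogPP C).ppGain n ρ = G.ppGain n ρ + C * (klRelGain n (max ρ 0) + ((2 : ℝ) ^ n)⁻¹) := rfl
/-- the amended freezing constant -/
theorem addShellLogPP_CF : (G.addShellLogPP C).CF = G.CF + 7 * C := rfl
/-- untouched field `phGain` -/
theorem addShellLogPP_phGain : (G.addShellLogPP C).phGain = G.phGain := rfl
/-- untouched field `cE4` -/
theorem addShellLogPP_cE4 : (G.addShellLogPP C).cE4 = G.cE4 := rfl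
/-- untouched field `atop` -/
theorem addShellLogPP_atop : (G.addShellLogPP C).atop = G.atop := rfl
/-- untouched field `abot` -/
theorem addShellLogPP_abot : (G.addShellLogPP C).abot = G.abot := rfl
/-- untouched field `blo` -/
theorem addShellLogPP_blo : (G.addShellLogPP C).blo = G.blo := rfl
/-- untouched field `bhi` -/
theorem addShellLogPP_bhi : (G.addShellLogPP C).bhi = G.bhi := rfl
/-- untouched field `cloc` -/
theorem addShellLogPP_cloc : (G.addShellLogPP C).cloc = G.cloc := rfl
/-- untouched field `θ` -/
theorem addShellLogPP_θ : (G.addShellLogPP C).θ = G.θ := rfl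
/-- untouched field `a` -/
theorem addShellLogPP_a : (G.addShellLogPP C).a = G.a := rfl
/-- untouched field `ζ` -/
theorem addShellLogPP_ζ : (G.addShellLogPP C).ζ = G.ζ := rfl
/-- untouched field `Z` -/
theorem addShellLogPP_Z : (G.addShellLogPP C).Z = G.Z := rfl
/-- untouched field `aplus` -/
theorem addShellLogPP_aplus : (G.addShellLogPP C).aplus = G.aplus := rfl
/-- untouched field `S` -/
theorem addShellLogPP_S : (G.addShellLogPP C).S = G.S := rfl
/-- untouched field `Bf` -/
theorem addShellLogPP_Bf : (G.addShellLogPP C).Bf = G.Bf := rfl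
/-- untouched field `SL` -/
theorem addShellLogPP_SL : (G.addShellLogPP C).SL = G.SL := rfl

variable {G C}

/-- **The amendment preserves well-formedness** (`0 ≤ C`): nonnegativity is kept and the pp freezing clause
`4^{−(t+1)} < ρ → Σ_{n ∈ (t,N]} ppGain n ρ ≤ CF` survives with `CF + 7C` (`Σ klRelGain ≤ 40/9 ≤ 5`, `Σ 2^{−n} ≤ 2`); the ph clause is untouched (its bound only grows). -/
theorem addShellLogPP_wf (hG : G.WF) (hC : 0 ≤ C) : (G.addShellLogPP C).WF := by
  obtain ⟨h1, h2, h3, h4, h5, h6, h7, h8, h9, h10, h11, h12, h13, h14, h15, h16, h17, h18, h19, h20⟩ := hG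
  refine ⟨h1, h2, h3, h4, h5, h6, h7, h8, h9, h10, h11, ?_, h13, ?_, ?_, ?_, h17, h18, h19, h20⟩
  · intro n ρ
    show 0 ≤ G.ppGain n ρ + C * (klRelGain n (max ρ 0) + ((2 : ℝ) ^ n)⁻¹)
    have := klRelGain_nonneg n (le_max_right ρ 0)
    have := h12 n ρ
    positivity
  · show 0 ≤ G.CF + 7 * C
    linarith
  · intro ρ N hρ
    show ∑ n ∈ range N, G.phGain n ρ ≤ G.CF + 7 * C
    exact (h15 ρ N hρ).trans (by linarith)
  · intro ρ t N hρ
    show ∑ n ∈ Ioc t N, (G.ppGain n ρ + C * (klRelGain n (max ρ 0) + ((2 : ℝ) ^ n)⁻¹)) ≤ G.CF + 7 * C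
    have hρ0 : 0 ≤ ρ := le_trans (by positivity) hρ.le
    rw [sum_add_distrib, ← mul_sum, sum_add_distrib, max_eq_left hρ0]
    have hA := h16 ρ t N hρ
    have hB := sum_Ioc_klRelGain_le t N hρ0
    have hC2 := sum_Ioc_inv_two_pow_le t N
    nlinarith

/-- The particle–particle gain grows: `G.ppGain n ρ ≤ (G.addShellLogPP C).ppGain n ρ` (`0 ≤ C`). -/
theorem ppGain_le_addShellLogPP (hC : 0 ≤ C) (n : ℕ) (ρ : ℝ) : G.ppGain n ρ ≤ (G.addShellLogPP C).ppGain n ρ := by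
  rw [addShellLogPP_ppGain]
  have := klRelGain_nonneg n (le_max_right ρ 0)
  have : 0 ≤ C * (klRelGain n (max ρ 0) + ((2 : ℝ) ^ n)⁻¹) := by positivity
  linarith

/-- **BOOKING LINE**: `C·(klRelGain n ρ + 2^{−n}) ≤ (G.addShellLogPP C).ppGain n ρ` (`0 ≤ ρ`, `0 ≤ G.ppGain n ρ`). -/
theorem klRelGain_le_addShellLogPP {n : ℕ} {ρ : ℝ} (hpp : 0 ≤ G.ppGain n ρ) (hρ : 0 ≤ ρ) :
    C * (klRelGain n ρ + ((2 : ℝ) ^ n)⁻¹) ≤ (G.addShellLogPP C).ppGain n ρ := by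
  rw [addShellLogPP_ppGain, max_eq_left hρ]
  linarith

/-- **BOOKING LINE, FROZEN BRANCH** (`Λₙ ≤ ρ`, the out-of-class pp transfers): `C·((Λₙ/ρ)·(1 + kₙ(ρ))) ≤ (G.addShellLogPP C).ppGain n ρ`
(`0 ≤ C`, `0 ≤ G.ppGain n ρ`) — the cross-scale shell count is hosted. -/
theorem shellCount_le_addShellLogPP (hC : 0 ≤ C) {n : ℕ} {ρ : ℝ} (hpp : 0 ≤ G.ppGain n ρ) (hρ : klScale klE0 n ≤ ρ) :
    C * (klScale klE0 n / ρ * (1 + (klShellCount n ρ : ℝ))) ≤ (G.addShellLogPP C).ppGain n ρ := by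
  have hΛ : 0 < klScale klE0 n := klth_klScale_pos n
  have hρ0 : 0 < ρ := hΛ.trans_le hρ
  have hmin : min (ρ / klScale klE0 n) (klScale klE0 n / ρ) = klScale klE0 n / ρ := by
    refine min_eq_right ?_
    rw [div_le_div_iff₀ hρ0 hΛ]
    nlinarith
  have hrel : klRelGain n ρ = klScale klE0 n / ρ * (1 + (klShellCount n ρ : ℝ)) := by
    unfold klRelGain; rw [hmin]
  refine le_trans ?_ (klRelGain_le_addShellLogPP (C := C) hpp hρ0.le)
  rw [← hrel]
  have : 0 ≤ ((2 : ℝ) ^ n)⁻¹ := by positivity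
  nlinarith

/-- The freezing constant grows (`0 ≤ C`). -/
theorem CF_le_addShellLogPP (hC : 0 ≤ C) : G.CF ≤ (G.addShellLogPP C).CF := by
  rw [addShellLogPP_CF]; linarith

/-- **`addShellLogPP` commutes with `addShellLog`** (ph and pp amendments touch different gains; the `CF` sums re-associate). -/
theorem addShellLogPP_addShellLog_comm (G : GeoConsts) (C C' : ℝ) : (G.addShellLog C).addShellLogPP C' = (G.addShellLogPP C').addShellLog C := by
  unfold GeoConsts.addShellLogPP GeoConsts.addShellLog
  congr 1
  ring

/-- **`addShellLogPP` commutes with `addTwoShell`**. -/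
theorem addShellLogPP_addTwoShell_comm (G : GeoConsts) (A C : ℝ) : (G.addTwoShell A).addShellLogPP C = (G.addShellLogPP C).addTwoShell A := by
  unfold GeoConsts.addShellLogPP GeoConsts.addTwoShell
  congr 1
  · funext n ρ; ring
  · ring

/-- **`addShellLogPP` commutes with `raiseCF`**. -/
theorem addShellLogPP_raiseCF_comm (G : GeoConsts) (x C : ℝ) : (G.raiseCF x).addShellLogPP C = (G.addShellLogPP C).raiseCF x := by
  unfold GeoConsts.addShellLogPP GeoConsts.raiseCF
  congr 1
  ring

end GeoConsts

/-! ## §3 The slots along `addShellLogPP` -/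

section Slots

variable {L M : ℕ} [NeZero L] [NeZero M] {G : GeoConsts} {P : SplitConsts} {Q : EngConsts} {β U μ : ℝ} {K : TrigPolyC4v} {n : ℕ} (C : ℝ)

/-- `thermalBar` grows along `addShellLogPP` (`0 ≤ C`). -/
theorem thermalBar_le_addShellLogPP (hC : 0 ≤ C) (P : SplitConsts) (U β : ℝ) (n : ℕ) :
    thermalBar G P U β n ≤ thermalBar (G.addShellLogPP C) P U β n := by
  unfold thermalBar
  rw [GeoConsts.addShellLogPP_CF]
  have : 0 ≤ (P.Klam * U) ^ 2 * ((4 : ℝ) ^ (nScales β - n))⁻¹ := by positivity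
  nlinarith

/-- `gainBar` grows along `addShellLogPP` (`0 ≤ C`; no sign hypothesis on `G`'s gains is needed). -/
theorem gainBar_le_addShellLogPP (hC : 0 ≤ C) (P : SplitConsts) (U : ℝ) (n : ℕ) (ρpp ρd ρx : ℝ) :
    gainBar G P U n ρpp ρd ρx ≤ gainBar (G.addShellLogPP C) P U n ρpp ρd ρx := by
  unfold gainBar
  rw [GeoConsts.addShellLogPP_ppGain, GeoConsts.addShellLogPP_phGain]
  have hK : 0 ≤ (P.Klam * U) ^ 2 := sq_nonneg _
  have hg := klRelGain_nonneg n (le_max_right ρpp 0)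
  have : 0 ≤ C * (klRelGain n (max ρpp 0) + ((2 : ℝ) ^ n)⁻¹) := by positivity
  nlinarith

/-- **THE OUT-OF-CLASS pp BOOKING TARGET**: at a frozen pp transfer `Λₙ ≤ ρpp` (`0 ≤ C`, `0 ≤ G`'s gains),
`(Klam U)²·C·((Λₙ/ρpp)·(1 + kₙ(ρpp))) ≤ gainBar (G.addShellLogPP C) P U n ρpp ρd ρx`. -/
theorem shellCount_le_gainBar_addShellLogPP (hC : 0 ≤ C) (hpp : ∀ n ρ, 0 ≤ G.ppGain n ρ) (hph : ∀ n ρ, 0 ≤ G.phGain n ρ)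
    (P : SplitConsts) (U : ℝ) {n : ℕ} {ρpp : ℝ} (hρ : klScale klE0 n ≤ ρpp) (ρd ρx : ℝ) :
    (P.Klam * U) ^ 2 * (C * (klScale klE0 n / ρpp * (1 + (klShellCount n ρpp : ℝ)))) ≤ gainBar (G.addShellLogPP C) P U n ρpp ρd ρx := by
  unfold gainBar
  have hK : 0 ≤ (P.Klam * U) ^ 2 := sq_nonneg _
  have h1 := GeoConsts.shellCount_le_addShellLogPP (G := G) hC (hpp n ρpp) hρ
  have h2 : 0 ≤ (G.addShellLogPP C).phGain n ρd := by rw [GeoConsts.addShellLogPP_phGain]; exact hph n ρd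
  have h3 : 0 ≤ (G.addShellLogPP C).phGain n ρx := by rw [GeoConsts.addShellLogPP_phGain]; exact hph n ρx
  nlinarith

/-- (E5-F) lifts along `addShellLogPP` (`0 ≤ C`). -/
theorem isoTupleL1AtV17F_addShellLogPP_of (hC : 0 ≤ C) (h : IsoTupleL1AtV17F L M G P β U μ n) :
    IsoTupleL1AtV17F L M (G.addShellLogPP C) P β U μ n := by
  intro B hB hvals m hm Ω hΩ x₁
  refine (h B hB hvals m hm Ω hΩ x₁).trans ?_
  rw [GeoConsts.addShellLogPP_CF]
  have hK : 0 ≤ (P.Klam * U) ^ 2 := sq_nonneg _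
  nlinarith

/-- (E4) does not read the gains or `CF`. -/
theorem engineFirstMoments_addShellLogPP_iff :
    EngineFirstMoments L M (G.addShellLogPP C) P Q β U μ K n ↔ EngineFirstMoments L M G P Q β U μ K n := Iff.rfl

/-- (E3a-F) reads only `G.S` (untouched). -/
theorem twoLegReadJetsF_addShellLogPP_iff :
    TwoLegReadJetsF L M (G.addShellLogPP C) Q β U μ n ↔ TwoLegReadJetsF L M G Q β U μ n := Iff.rfl

end Slots

end Summit.HubbardSuperconductivity.HubbardSuperconductivity.Theorems.KLRegimeSplit

end
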